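import Summits.HodgeConjecture.HodgeConjecture.Theses.RigidRelativesJacobianTorelli
import Literature.NumberTheory.EllipticCurves.KugaSatoVariety
import Literature.AlgebraicGeometry.Motives.BaseChangeProofs

/-!
# Birth skeleton (BC3) of the crux `CMCorrespondenceTate` (stmt-HodgeConjecture-18580),
# route `RigidRelativesJacobianTorelli` — line `birth`: "the CM face through the Kuga–Sato hub"

`CMCorrespondenceTate` (crux, rank 4 of the route) is TATE FOR `X × X`, CM FACE: for `X₀/ℚ` a
smooth projective threefold of RIGID TYPE (`b₃(X₀ ⊗ ℂ) = 2` with a non-zero `(3,0)`-class, so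
`H³ = H^{3,0} ⊕ H^{0,3}`) whose `ℓ`-adic `H³` admits a NON-SCALAR endomorphism commuting with an
open subgroup of `Gal(ℚ̄/ℚ)` (`GalCM`), there is a NON-SCALAR endomorphism of `H³(X(ℂ); ℂ)` induced
by an algebraic self-correspondence of `X_ℂ = X₀ ⊗_ℚ ℂ` (`IsAlgebraicCorrespondence 3 3 X_ℂ X_ℂ Θ`).

The line cuts the crux through the one hub where both the Galois side and the cycle side are in
print — the weight-4 KUGA–SATO THREEFOLD `W` (Deligne 1969 / Scholl 1990: the motive of a weight-4
newform `f` is cut out of `H³(W)` by algebraic projectors) — along four genuinely different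
statements, none of which is the crux or the summit reworded:

  X₀ rigid type
    ⟹ (STUB 1 `stub_kugaSatoAnchor`, the ANCHOR = Tate for `X × W`, Hom face — OPEN) `H³(X_ℂ)`
      embeds into `H³(W_ℂ)` of some weight-4 full-level-`N` Kuga–Sato threefold over `ℂ` by an
      injective, rationality-preserving map induced by an algebraic correspondence on `W × X_ℂ`
      (modularity of rigid-type threefolds, Gouvêa–Yui / Dieulefait + Serre's conjecture, gives the
      GALOIS isomorphism `H³_ét(X) ≅ ρ_f`; Faltings–Serre makes it effective; the geometric
      realisation by a correspondence is known only case by case: Schoen's quintic, the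
      self-fibre-products of elliptic surfaces, Hulek–Verrill, Livné–Schütt–Yui …);
    ⟹ (STUB 2 `stub_kugaSatoCMTwist`, the CM TWIST — load-bearing, "in print modulo the CM
      case": given `GalCM X₀` and ANY such anchor `A`, some algebraic self-correspondence `R` of
      `W` preserves `im A` and acts on it NON-SCALARLY: `R ∘ A = A ∘ T`, `T ∉ ℂ·id`. Mechanism:
      `GalCM` + Ribet's open-image theorem force the newforms meeting `im A` to be CM by an imaginary
      quadratic `K`; on each CM block the Hecke correspondences generate the multiplicity algebra
      and the TWISTING OPERATOR of the self-twist `(id, χ_K)` — realised as an explicit algebraic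
      correspondence on the Kuga–Sato variety of level `N·D²` by Shimura 1973 / Ribet 1980 Thm. 5.1 /
      Momose 1981 / Brown–Ghate 2003 §2.3 (Thm. 2.3.8, Lemmas 2.3.10–2.3.14, correspondence `α`) —
      does not commute with `Gal(ℚ̄/ℚ)`, so together they generate `K ⊗ 1`, the CM acting
      diagonally on the `K`-isotypic part, which preserves every sub-Hodge-structure `im A` and is
      non-scalar on it. Brown–Ghate treat NON-CM forms and write (p. 1618) "We have not
      investigated the structure of `X_f` when `f` has complex multiplication and `k > 2`" — the
      gap this stub names);
    ⟹ (STUB 3 `stub_algebraicLeftInverse`, ALGEBRAIC LEFT INVERSE — true in print, L/XL on the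
      tree: an injective rationality-preserving algebraic `A : H³(X_ℂ) → H³(W)` from a rigid-type
      threefold has an ALGEBRAIC LEFT INVERSE `L`, `L ∘ A = id`: the transpose `ᵗA` (same cycle,
      read backwards; middle degree, so no Lefschetz operator is needed — Kleiman 1968 §3,
      Lieberman 1968) is algebraic, `ᵗA ∘ A ∈ End H³(X_ℂ)` is invertible because the cup pairing
      is definite on `im A ⊆ H^{3,0}(W) ⊕ H^{0,3}(W) ⊆ P³(W)` (Hodge–Riemann; this is where RIGID
      TYPE and RATIONALITY of `A` are used), and the inverse of an invertible element of the
      finite-dimensional algebra of algebraic endomorphisms is a polynomial in it (Cayley–Hamilton),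
      so `L := (ᵗA A)⁻¹ ᵗA`; = `RigidUnwinding.AlgebraicInverse` (stmt-HodgeConjecture-13657) in
      left-inverse form);
    ⟹ (STUB 4 `stub_algebraicComp`, COMPOSITION OF CORRESPONDENCES on the tree's real carriers —
      Fulton 16.1.1, routine in print, L on the tree (no such lemma exists yet for
      `IsAlgebraicCorrespondence`): `S ∘ T` is algebraic when `S`, `T` are, stated for
      equidimensional smooth projective `X, Y, Z` and one cohomological degree, which is all the
      composition needs and avoids the `ℕ`-degree corner cases of the general signature).

Then `Θ := L ∘ R ∘ A = L ∘ A ∘ T = T` is algebraic (STUB 4 twice) and non-scalar (STUB 2): the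
composition `CMCorrespondenceTate_of` is ten lines of logic, kernel-checked, no `sorry`.

Why the hub is PINNED to Kuga–Sato and the anchor carries RATIONALITY: with an arbitrary smooth
projective `W` (e.g. `W = X_ℂ`, `A = id`) STUB 2 would be the crux in costume; on a Kuga–Sato
variety it is the twisting-operator theorem. Rationality of `A` (automatic for a `ℚ`-cycle; the
tree's `algebraicClasses` is a `ℂ`-span, so it must be asked for) is what makes `im A` a
sub-`ℚ`-Hodge structure stable under complex conjugation (STUB 3) and lets Galois act on `im A_ℓ`
(STUB 2). `K = ℂ` in `KugaSatoVariety ℂ 2 N` keeps every signature free of base change along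
embeddings: the Galois datum enters only through `X₀`'s own étale `H³` in `GalCM`, exactly as in
the crux.

## Contents

* `cx`, `Rigid`, `GalCM` — VERBATIM the three `let`s of the route decl (checked by
  `cmCorrespondenceTate_iff`, `Iff.rfl`);
* `IsAnchor X₀ W A` — `A : H³(X_ℂ) → H³(W)` is induced by an algebraic correspondence on
  `W × X_ℂ`, injective, and maps rational classes to rational classes;
* `stub_kugaSatoAnchor` (STUB 1, open: Tate/Hodge for `X × W`, the "geometric realisation
  problem"), `stub_kugaSatoCMTwist` (STUB 2, load-bearing: twisting operators are motivic, CM case),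
  `stub_algebraicLeftInverse` (STUB 3, in print: transpose + Hodge–Riemann + Cayley–Hamilton),
  `stub_algebraicComp` (STUB 4, in print: Fulton 16.1.1 on the real carriers) — `sorry` ONLY here;
* `CMCorrespondenceTate_of` — the composition stub₁ → stub₂ → stub₃ → stub₄ → the crux BY NAME
  (`Summit.HodgeConjecture.HodgeConjecture.Theses.RigidRelativesJacobianTorelli.CMCorrespondenceTate`),
  no `sorry`; `CMCorrespondenceTate_of_stubs` — the crux modulo exactly the four stubs.

Disproof used: none on file (`ledger crux ls stmt-HodgeConjecture-18580`: "(no workfiles yet)" at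
registration — no `Disproof.lean`, no ideas, no lines; the item carries no `_false_without_`
theorem). Negatives index (`ledger negatives --problem HodgeConjecture`, 3 entries:
`MilnorKExponentialSymbolLift`, `DerivedTorelliFermatK3Exhaustion`, `ELineTransportELineConnectivity`):
none concerns Kuga–Sato varieties, CM twists, inverses or compositions of correspondences.

This file re-registers, as a crux WORKFILE readable by every seat, the birth skeleton whose first
registration (planner-type-c78777bc55-0, sha 3241dbef…) was attached as item evidence only and was
unreadable from the vet seat (`VET-BLOCKED.md` on the item); same four stub names.
-/

noncomputable section

namespace Summit.HodgeConjecture.HodgeConjecture.Cruxes.CMCorrespondenceTate.Birth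

open CategoryTheory AlgebraicGeometry
open Literature.AlgebraicGeometry.Motives Literature.AlgebraicGeometry.HodgeTheory
open Literature.NumberTheory.EllipticCurves (KugaSatoVariety)
open Summit.HodgeConjecture.HodgeConjecture.Theses.RigidRelativesJacobianTorelli
  (CMCorrespondenceTate)

/-! ### The predicates of the cut (verbatim the route's `let`s) -/

/-- `X₀ ⊗_ℚ ℂ` — verbatim the route's `cx`. [folklore] -/
abbrev cx (Y₀ : SchemeOver.{0} ℚ) : SchemeOver.{0} ℂ := (baseChange ℚ ℂ).obj Y₀

/-- **Rigid type** — verbatim the route's `Rigid`: `X₀/ℚ` smooth projective of dimension `3`,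
`b₃(X₀ ⊗ ℂ) = 2`, and some non-zero class of `H³(X(ℂ); ℂ)` is of Hodge type `(3,0)` (so
`H³ = H^{3,0} ⊕ H^{0,3}`, `h^{3,0} = h^{0,3} = 1`: the Hodge shape of a rigid Calabi–Yau threefold,
without asking `K_X = 0`). [cite: GouveaYui2011, §1] -/
def Rigid (Y₀ : SchemeOver.{0} ℚ) : Prop :=
  IsSmoothProjective 3 Y₀ ∧ Module.finrank ℂ (complexBetti (cx Y₀) 3) = 2 ∧
    ∃ x : complexBetti (cx Y₀) 3, x ≠ 0 ∧ IsOfHodgeType 3 (cx Y₀) 3 3 0 x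

/-- **Galois-detected CM** — verbatim the route's `GalCM`: for some prime `ℓ`, the rational
`ℓ`-adic `H³` of the geometric fibre of `X₀` carries a NON-SCALAR `ℚ_ℓ`-linear endomorphism
commuting with the action of an open subgroup of `Gal(ℚ̄/ℚ)` (for `b₃ = 2`: the restriction of
`ρ_{X,ℓ}` to some open subgroup is abelian — potentially CM). [cite: Ribet1980TwistsEndoAlgs, §4–5] -/
def GalCM (Y₀ : SchemeOver.{0} ℚ) : Prop :=
  ∃ (ℓ : ℕ) (_ : Fact ℓ.Prime) (U : OpenSubgroup (Field.absoluteGaloisGroup ℚ))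
    (T : ellAdicEtaleCohomologyRat ℓ 3 (geometricFibre ℚ Y₀) →ₗ[ℚ_[ℓ]]
      ellAdicEtaleCohomologyRat ℓ 3 (geometricFibre ℚ Y₀)),
    (∀ g ∈ U, T ∘ₗ geometricEllAdicEtaleCohomologyRepRat ℓ Y₀ 3 g =
        geometricEllAdicEtaleCohomologyRepRat ℓ Y₀ 3 g ∘ₗ T) ∧
      ∀ c : ℚ_[ℓ], T ≠ c • LinearMap.id

/-- **Anchor** of `X₀` in a complex variety `W` (used with `W` a weight-4 Kuga–Sato threefold):
a `ℂ`-linear `A : H³(X(ℂ); ℂ) → H³(W(ℂ); ℂ)` induced by an algebraic correspondence on `W × X_ℂ`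
(`IsAlgebraicCorrespondence 3 3 W X_ℂ A`: target `W`, source `X_ℂ`, both of dimension `3`),
injective, and carrying rational classes to rational classes (automatic for the class of a cycle
with `ℚ`-coefficients; asked for because `algebraicClasses` is a `ℂ`-span).
[cite: Kleiman1968, §3] [cite: Andre1996Motifs, §2.1] -/
def IsAnchor (X₀ : SchemeOver.{0} ℚ) (W : SchemeOver.{0} ℂ)
    (A : complexBetti (cx X₀) 3 →ₗ[ℂ] complexBetti W 3) : Prop :=
  IsAlgebraicCorrespondence 3 3 W (cx X₀) A ∧ Function.Injective A ∧
    ∀ x : complexBetti (cx X₀) 3, IsRationalClass x → IsRationalClass (A x)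

/-- `Rigid`, `GalCM`, `cx` are VERBATIM the route's `let`s: the crux unfolds, definitionally, to
"rigid type + Galois-detected CM ⟹ a non-scalar algebraic self-correspondence on `H³(X_ℂ)`".
[folklore] -/
theorem cmCorrespondenceTate_iff :
    CMCorrespondenceTate ↔
      ∀ ⦃X₀ : SchemeOver.{0} ℚ⦄, Rigid X₀ → GalCM X₀ →
        ∃ Θ : complexBetti (cx X₀) 3 →ₗ[ℂ] complexBetti (cx X₀) 3,
          IsAlgebraicCorrespondence 3 3 (cx X₀) (cx X₀) Θ ∧ ∀ c : ℂ, Θ ≠ c • LinearMap.id :=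
  Iff.rfl

/-! ### The four registered stubs -/

/-- STUB 1 (THE ANCHOR = Tate/Hodge for `X × W`, Hom face; OPEN) — **every rigid-type threefold
over `ℚ` is anchored in a weight-4 Kuga–Sato threefold.** For `X₀/ℚ` of rigid type there are a
level `N`, a Kuga–Sato variety `W` over `ℂ` with `2` factors and full level `N` (dimension `3`,
weight `4`), and an anchor `A : H³(X(ℂ); ℂ) ↪ H³(W(ℂ); ℂ)` (`IsAnchor`). Why plausibly true:
`ρ_{X,ℓ} = H³_ét(X_ℚ̄, ℚ_ℓ)` is `2`-dimensional, odd, of Hodge–Tate weights `{0, 3}`, hence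
(Serre's conjecture = Khare–Wintenberger, Kisin; Dieulefait–Manoharmayum, Gouvêa–Yui 2011 Thm. 2)
`ρ_{X,ℓ} ≅ ρ_{f,ℓ}` for a weight-4 newform `f` of level `N | ∏ bad p`, and `ρ_f` is cut out of
`H³_ét` of the level-`N` Kuga–Sato threefold by Scholl's projector (Scholl 1990 Thm. 1.2.4); the
Tate conjecture for `X × W` (equivalently, here, the Hodge conjecture for `X_ℂ × W`: Faltings–Serre
+ comparison make the Hodge structures `H³(X) ≅ V(f)` isomorphic as soon as the Galois modules
are, for rigid type both are rank `2` of type `(3,0)+(0,3)` with the same CM/non-CM dichotomy) then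
realises the isomorphism by a cycle on `W × X`, defined over `ℚ̄`, with `ℚ`-coefficients — an
injective, rationality-preserving algebraic `A`. Why it might fail / why it is hard: this IS the
"geometric realisation problem" for modular rigid Calabi–Yau threefolds (Yui's surveys; Meyer
2005), settled only case by case — Schoen's quintic and the Hirzebruch/Schoen fibre products of
rational elliptic surfaces (where `W` itself is a fibre product), the Hulek–Verrill toric family,
Livné–Schütt–Yui for CM newforms with rational coefficients (all realised in fibre products) — and
NO engine beyond fibre-product / Kuga–Sato-type constructions is known; a rigid-type `X₀` that is
not dominated by (a quotient of) a fibre product of elliptic surfaces is out of reach of every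
method in print. Size: XL / open (it is the Hom face of the route's own `RelativesTate`). Leans on:
`KugaSatoVariety` and the unproved named fact
`Literature.NumberTheory.EllipticCurves.nonempty_kugaSatoVariety` (existence for `N ≥ 3`),
`IsAlgebraicCorrespondence`, `IsRationalClass`; modularity and Faltings–Serre are not on the tree.
[cite: GouveaYui2011, Thm. 2] [cite: Scholl1990, Thm. 1.2.4] [cite: Faltings1983Endlichkeit, Satz 4]
[cite: HulekVerrill2006, Thm. 1.1] [cite: LivneSchuttYui2010, Thm. 1] -/
theorem stub_kugaSatoAnchor :
    ∀ X₀ : SchemeOver.{0} ℚ, Rigid X₀ →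
      ∃ (N : ℕ) (V : KugaSatoVariety ℂ 2 N)
        (A : complexBetti (cx X₀) 3 →ₗ[ℂ] complexBetti V.W 3), IsAnchor X₀ V.W A := by
  sorry

/-- STUB 2 (THE CM TWIST; load-bearing — "twisting operators are motivic", CM case) — **on a
Kuga–Sato hub, Galois-detected CM is realised by an algebraic self-correspondence preserving the
anchored copy of `H³(X)` and non-scalar on it.** For `X₀` of rigid type with `GalCM X₀` and ANY
anchor `A : H³(X_ℂ) ↪ H³(W)` into a weight-4 level-`N` Kuga–Sato threefold `W/ℂ`, there are an
algebraic `R : H³(W) → H³(W)` (`IsAlgebraicCorrespondence 3 3 W W R`) and a NON-SCALAR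
`T : H³(X_ℂ) → H³(X_ℂ)` with `R ∘ A = A ∘ T`. Why plausibly true (the intended proof): (i) `W` is,
up to an isomorphism of `ℂ`-schemes (which transports cycles), the base change of Deligne's model
`W_N/ℚ(ζ_N)`, so `H³(W(ℂ); ℚ)` carries a `Gal(ℚ̄/ℚ(ζ_N))`-structure compatible with cycle maps;
`A` may be taken (same image) to be a `ℚ`-cycle defined over a number field `F` (spread out and
specialise: the tree's `AlgebraicCyclesDefinedOverQbar*`), so `im A_ℓ ⊆ H³_ét(W)` is `G_F`-stable
and `G_F`-isomorphic to `H³_ét(X)`; (ii) `GalCM` gives a non-scalar endomorphism of `ρ_{X,ℓ}|_U`,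
so by Ribet's open-image theorem for non-CM newforms of weight `≥ 2` (Ribet 1980/1985, Momose 1981)
every newform `g` (level `| N`, weight `4`) whose Scholl piece meets `im A` is CM, by one imaginary
quadratic `K` (all such `V(g)` are `ℚ`-Hodge-isomorphic to `H³(X_ℂ; ℚ)`, rank `2`, type
`(3,0)+(0,3)`, `End_HS = K`); (iii) on the `K`-CM part `I = ⊕_g V(g) ⊗ M_g` of `H³(W; ℚ)` the
algebra generated by algebraic self-correspondences contains: the Hecke correspondences and the
`GL₂(ℤ/N)`-action (generating `1 ⊗ End M_g`, Scholl 1990 §4, Deligne 1969), and for each `g` the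
TWISTING OPERATOR `η` of the self-twist `g ⊗ χ_K = g`, an explicit correspondence on the Kuga–Sato
variety of level `N D_K²` (Shimura 1973 Prop. 3; Ribet 1980 Thm. 5.1; Momose 1981; Brown–Ghate 2003
Thm. 2.3.8 with Lemmas 2.3.10–2.3.14: the cycle `α = Σ_u χ(u)·Γ(z ↦ z + u/D)` and its lift to the
fibre product), moved to level `N` by the (algebraic) degeneracy correspondences; `η ∘ σ = χ_K(σ) σ ∘ η`
for `σ ∈ Gal`, so `η ∉ 1 ⊗ End M_g` and `η ≠ 0` (`η² = χ_K(−1) D_K · unit`, Ribet (5.3)); hence the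
algebra contains `K ⊗ 1` — complex multiplication by `K` acting DIAGONALLY on `I`; (iv) `R := `
(CM by a generator `θ` of `K` on `I`) `∘` (algebraic projector onto `I`) preserves every sub-Hodge
structure of `I`, in particular `im A`, and `R ∘ A = A ∘ T` with `T` = the transport of `θ` to
`End_HS H³(X_ℂ; ℚ) = K` (well defined because `K` is commutative), non-scalar. Why it might fail /
why it is hard: the motivic realisation of twisting operators is in print for NON-CM forms only —
Brown–Ghate p. 1618: "We have not investigated the structure of `X_f` when `f` has complex
multiplication and `k > 2`" — and for the CM self-twist the operator `η` acts on the `1`-dimensional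
space `ℂ·g` by a Gauss-sum SCALAR, so its non-scalarity on the rank-`2` motive must be read off the
Galois relation `ησ = χ(σ)ση`, not off `q`-expansions; step (i) needs the comparison between the
abstract `KugaSatoVariety ℂ 2 N` of the tree and Deligne's model (birational invariance of the
`(3,0)+(0,3)` part, `GL₂(ℤ/N)`-equivariance), and step (iii) needs Hecke correspondences as cycles on
`W × W`, which the tree does not have yet (the route's definition request). Size: XL. Leans on:
`KugaSatoVariety` (fields `W`, `slW`, `translW`), `IsAlgebraicCorrespondence`,
`geometricEllAdicEtaleCohomologyRepRat`, `Field.absoluteGaloisGroup`; Ribet's open image, Scholl's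
projectors, comparison étale/Betti are not on the tree.
[cite: BrownGhate2003, Thm. 2.3.8, Lemmas 2.3.10 and 2.3.14, p. 1618]
[cite: Ribet1980TwistsEndoAlgs, Thm. 5.1 and (5.3)] [cite: Momose1981, Thm. 4.2]
[cite: Shimura1973ThetaCM, Prop. 3] [cite: Scholl1990, Thm. 1.2.4 and §4] -/
theorem stub_kugaSatoCMTwist :
    ∀ X₀ : SchemeOver.{0} ℚ, Rigid X₀ → GalCM X₀ →
      ∀ (N : ℕ) (V : KugaSatoVariety ℂ 2 N)
        (A : complexBetti (cx X₀) 3 →ₗ[ℂ] complexBetti V.W 3), IsAnchor X₀ V.W A →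
          ∃ (R : complexBetti V.W 3 →ₗ[ℂ] complexBetti V.W 3)
            (T : complexBetti (cx X₀) 3 →ₗ[ℂ] complexBetti (cx X₀) 3),
            IsAlgebraicCorrespondence 3 3 V.W V.W R ∧ R ∘ₗ A = A ∘ₗ T ∧
              ∀ c : ℂ, T ≠ c • LinearMap.id := by
  sorry

/-- STUB 3 (ALGEBRAIC LEFT INVERSE; true in print, L/XL on the tree) — **an anchor of a
rigid-type threefold has an algebraic left inverse.** For `X₀` of rigid type, `W/ℂ` smooth
projective of dimension `3` and an anchor `A : H³(X_ℂ) ↪ H³(W)` (algebraic, injective,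
rationality-preserving) there is `L : H³(W) → H³(X_ℂ)` induced by an algebraic correspondence on
`X_ℂ × W` with `L ∘ A = id`. Why plausibly true (the proof in print): the TRANSPOSE `ᵗA : H³(W) →
H³(X_ℂ)` (the same cycle on `W × X_ℂ` read as a correspondence from `W` to `X_ℂ`; both degrees are
the middle degree `3`, so Poincaré duality alone, no Lefschetz/`Λ`, intervenes — Kleiman 1968 §3,
Lieberman 1968) is algebraic; `im A` is a sub-`ℚ`-Hodge structure of `H³(W; ℚ)` (rational `A` is a
morphism of Hodge structures defined over `ℚ`) of type `(3,0)+(0,3)` (rigid type), hence inside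
the primitive part `P³(W)` on which the polarisation `(x, y) ↦ i³ ∫ x ∪ ȳ` is DEFINITE type by
type (Hodge–Riemann bilinear relations, Voisin I Thm. 6.32), so the cup pairing of `W` is
non-degenerate on `im A` and `ᵗA ∘ A : H³(X_ℂ) → H³(X_ℂ)` — the cup pairing of `W` pulled back by
`A`, read through Poincaré duality of `X_ℂ` — is INVERTIBLE; it lies in the finite-dimensional
`ℚ`-algebra of endomorphisms induced by algebraic self-correspondences of `X_ℂ` (composition,
STUB 4's mechanism), and an element of a finite-dimensional algebra invertible as a linear map has
its inverse a polynomial in itself (Cayley–Hamilton), so `(ᵗA A)⁻¹` and `L := (ᵗA A)⁻¹ ∘ ᵗA` are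
algebraic, `L ∘ A = id`. This is `RigidUnwinding.AlgebraicInverse` (stmt-HodgeConjecture-13657:
"`Ψ†Ψ ∈ End_HS(T_X) = K` … its inverse is a `ℚ`-polynomial in `Ψ†Ψ`") in left-inverse form. Why
it might fail / why it is hard: on the tree it needs the transpose of `corrClassAction` to be a
`corrClassAction` (swap of factors on `W ⊗ X`, orientation bookkeeping), the projection formula,
Hodge–Riemann in degree `3` for `W` (only the abstract `HodgeModel` exists), and the rationality
of `im A` as a `ℚ`-structure — each routine in print, none formalised; without RIGID TYPE (mixed
`(2,1)` classes, possibly non-primitive in `W`) or without RATIONALITY (an isotropic line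
`im A ⊆ H^{3,0}`) the pairing on `im A` can degenerate and the statement is false, which is why
both hypotheses are carried. Size: L/XL (tree infrastructure), known in print. Leans on:
`IsAlgebraicCorrespondence`, `corrClassAction`, `HomologicalOrientation.HasPoincareDuality`,
`IsRationalClass`, `IsOfHodgeType`, `HodgeModel`.
[cite: Kleiman1968, §3 (transpose of a correspondence, Prop. 3.5)] [cite: Lieberman1968, Thm. 1]
[cite: VoisinHodgeI2002, Thm. 6.32] [cite: Andre1996Motifs, §2.1] -/
theorem stub_algebraicLeftInverse :
    ∀ X₀ : SchemeOver.{0} ℚ, Rigid X₀ →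
      ∀ (W : SchemeOver.{0} ℂ), IsSmoothProjective 3 W →
        ∀ (A : complexBetti (cx X₀) 3 →ₗ[ℂ] complexBetti W 3), IsAnchor X₀ W A →
          ∃ L : complexBetti W 3 →ₗ[ℂ] complexBetti (cx X₀) 3,
            IsAlgebraicCorrespondence 3 3 (cx X₀) W L ∧ L ∘ₗ A = LinearMap.id := by
  sorry

/-- STUB 4 (COMPOSITION OF CORRESPONDENCES on the real carriers; Fulton 16.1.1, routine in print,
L on the tree) — for `X, Y, Z` smooth projective over `ℂ` of the same dimension `n` and linear maps
`T : Hᵏ(X) → Hᵏ(Y)`, `S : Hᵏ(Y) → Hᵏ(Z)` induced by algebraic correspondences (classes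
`γ ∈ Nᵉ(Y × X)`, `δ ∈ Nᵉ'(Z × Y)`), the composite `S ∘ T : Hᵏ(X) → Hᵏ(Z)` is induced by the
algebraic class `δ ∘ γ = pr_{ZX*}(pr_{ZY}^* δ ∪ pr_{YX}^* γ) ∈ N(Z × X)` (push-forwards, pull-backs,
exterior and cup products of algebraic classes are algebraic; the identity `(δ ∘ γ)_* = δ_* ∘ γ_*`
is the projection formula + base change for the square of projections). Why plausibly true: it is
Fulton's Prop. 16.1.1 / Kleiman 1968 §3 / Voisin II Prop. 9.7 (21.13); stated in one degree `k`
and one dimension `n` (all the line needs: `k = n = 3`), which keeps the `ℕ`-bookkeeping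
`a + 2e = b + 2n`, `b + q = 2m` of `IsAlgebraicCorrespondence` solvable (`e = n`, `q = 2n − k`
for `k ≤ 2n`; for `k > 2n` the cohomology vanishes and `IsAlgebraicCorrespondence` still needs a
witness — the one corner a prover must check, harmless here). Why it might fail / why it is hard:
on the tree `corrClassAction` is built from `gysinMap`/`cupProduct`/`complexBetti.map` on
`ComplexPoints (W ⊗ X)` with chosen orientations; the proof needs the projection formula and the
base-change formula for Gysin maps of the projections `Z × Y × X → Z × X` etc., Künneth
compatibility of `algebraicClasses` (exterior product of cycle classes = cycle class of the
product cycle) and independence of orientation — none formalised (the tree has `gysinMap` but no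
projection formula); no mathematical risk. Size: L (infrastructure). Leans on:
`IsAlgebraicCorrespondence`, `corrClassAction`, `algebraicClasses`, `gysinMap`, `cupProduct`.
[cite: Fulton1998, Prop. 16.1.1 and Def. 16.1.2] [cite: Kleiman1968, §3]
[cite: VoisinHodgeII2003, Prop. 9.7 and (21.13)] -/
theorem stub_algebraicComp :
    ∀ (n k : ℕ) (X Y Z : SchemeOver.{0} ℂ),
      IsSmoothProjective n X → IsSmoothProjective n Y → IsSmoothProjective n Z →
        ∀ (T : complexBetti X k →ₗ[ℂ] complexBetti Y k) (S : complexBetti Y k →ₗ[ℂ] complexBetti Z k),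
          IsAlgebraicCorrespondence n n Y X T → IsAlgebraicCorrespondence n n Z Y S →
            IsAlgebraicCorrespondence n n Z X (S ∘ₗ T) := by
  sorry

/-! ### The composition -/

/-- **THE LINE'S COMPOSITION** (kernel-checked, no `sorry`): if every rigid-type `X₀/ℚ` is
anchored in a weight-4 Kuga–Sato threefold (STUB 1), Galois-detected CM is realised on the hub by
an algebraic `R` with `R ∘ A = A ∘ T`, `T` non-scalar (STUB 2), anchors of rigid-type threefolds
have algebraic left inverses (STUB 3), and algebraic correspondences compose (STUB 4), then
`CMCorrespondenceTate`: `Θ := L ∘ (R ∘ A)` is algebraic by STUB 4 (twice) and equals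
`L ∘ A ∘ T = T`, which is non-scalar. [cite: BrownGhate2003, Thm. 2.3.8] [cite: Kleiman1968, §3] -/
theorem CMCorrespondenceTate_of :
    (∀ X₀ : SchemeOver.{0} ℚ, Rigid X₀ →
      ∃ (N : ℕ) (V : KugaSatoVariety ℂ 2 N)
        (A : complexBetti (cx X₀) 3 →ₗ[ℂ] complexBetti V.W 3), IsAnchor X₀ V.W A) →
    (∀ X₀ : SchemeOver.{0} ℚ, Rigid X₀ → GalCM X₀ →
      ∀ (N : ℕ) (V : KugaSatoVariety ℂ 2 N)
        (A : complexBetti (cx X₀) 3 →ₗ[ℂ] complexBetti V.W 3), IsAnchor X₀ V.W A →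
          ∃ (R : complexBetti V.W 3 →ₗ[ℂ] complexBetti V.W 3)
            (T : complexBetti (cx X₀) 3 →ₗ[ℂ] complexBetti (cx X₀) 3),
            IsAlgebraicCorrespondence 3 3 V.W V.W R ∧ R ∘ₗ A = A ∘ₗ T ∧
              ∀ c : ℂ, T ≠ c • LinearMap.id) →
    (∀ X₀ : SchemeOver.{0} ℚ, Rigid X₀ →
      ∀ (W : SchemeOver.{0} ℂ), IsSmoothProjective 3 W →
        ∀ (A : complexBetti (cx X₀) 3 →ₗ[ℂ] complexBetti W 3), IsAnchor X₀ W A →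
          ∃ L : complexBetti W 3 →ₗ[ℂ] complexBetti (cx X₀) 3,
            IsAlgebraicCorrespondence 3 3 (cx X₀) W L ∧ L ∘ₗ A = LinearMap.id) →
    (∀ (n k : ℕ) (X Y Z : SchemeOver.{0} ℂ),
      IsSmoothProjective n X → IsSmoothProjective n Y → IsSmoothProjective n Z →
        ∀ (T : complexBetti X k →ₗ[ℂ] complexBetti Y k) (S : complexBetti Y k →ₗ[ℂ] complexBetti Z k),
          IsAlgebraicCorrespondence n n Y X T → IsAlgebraicCorrespondence n n Z Y S →
            IsAlgebraicCorrespondence n n Z X (S ∘ₗ T)) →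
    Summit.HodgeConjecture.HodgeConjecture.Theses.RigidRelativesJacobianTorelli.CMCorrespondenceTate := by
  intro hA hT hL hC
  refine cmCorrespondenceTate_iff.2 fun X₀ hX hG => ?_
  obtain ⟨N, V, A, hAV⟩ := hA X₀ hX
  obtain ⟨R, T, hR, hRA, hTns⟩ := hT X₀ hX hG N V A hAV
  have hW : IsSmoothProjective 3 V.W := V.smoothProjective
  obtain ⟨L, hLalg, hLA⟩ := hL X₀ hX V.W hW A hAV
  have hX' : IsSmoothProjective 3 (cx X₀) := hX.1.baseChange_obj ℂ
  refine ⟨L ∘ₗ (R ∘ₗ A), ?_, ?_⟩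
  · exact hC 3 3 (cx X₀) V.W (cx X₀) hX' hW hX' (R ∘ₗ A) L
      (hC 3 3 (cx X₀) V.W V.W hX' hW hW A R hAV.1 hR) hLalg
  · have hΘ : L ∘ₗ (R ∘ₗ A) = T := by
      rw [hRA, ← LinearMap.comp_assoc, hLA, LinearMap.id_comp]
    intro c
    rw [hΘ]
    exact hTns c

/-- **The crux, closed modulo exactly the four registered stubs.** -/
theorem CMCorrespondenceTate_of_stubs :
    Summit.HodgeConjecture.HodgeConjecture.Theses.RigidRelativesJacobianTorelli.CMCorrespondenceTate :=
  CMCorrespondenceTate_of stub_kugaSatoAnchor stub_kugaSatoCMTwist stub_algebraicLeftInverse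
    stub_algebraicComp

end Summit.HodgeConjecture.HodgeConjecture.Cruxes.CMCorrespondenceTate.Birth

end
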